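import Literature.AlgebraicGeometry.Resolution.StrictNormalCrossingsOpen
import HarnessLib

/-!
# Crux `PatchingRelPerfect` (stmt-ResolutionOfSingularities-16161), chain W5.2 — F7(β) (β-AX) A1 bridge (c), RING LEVEL:
# a FAMILY of elements with independent differentials at a prime keeps independent differentials (for the sub-family
# vanishing at the prime) throughout a basic open neighbourhood, on a Noetherian ring whose relevant quotients have
# open regular loci

[OURS · L1 W5.2 · rung tool; res-L1-w52-plan-1 RULING G11-17 (4) / NAMING 2026-08-27T16:26:25Z → res-D-pv-046]
Replaces the role of NO printed item of the manuscript under review; fact-free; any dimension, any characteristic.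
This is the ring-level half of the OPENNESS LEMMA for the pointwise simple-normal-crossings predicate `SNCWithAt`
(`…DepthSNCPointwise.lean`); the scheme-level half is `…DepthSncLocusOpen.lean`. It is the «family» variant of the
tree's `IsSNCIdeal.exists_notMem_forall` (`Literature/…/StrictNormalCrossingsOpen.lean`, whose §«Proof» it follows
step by step and whose lemmas it re-uses BY NAME): there ONE ideal `(a₁ ⋯ a_r)` is spread; here the individual
`aᵢ` are, and the openness of the regular loci of the quotients `R ⧸ (aᵢ : i ∈ T)` is a HYPOTHESIS (`IsOpen (regularLocus _)`,
discharged at scheme level from quasi-excellence = the J-2 property) instead of coming from a perfect ground field.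

* `exists_notMem_forall_isRegularLocalRing_quotient_of_isOpen` — the tree's
  `exists_notMem_forall_isRegularLocalRing_quotient` with the perfect-field hypothesis replaced by
  `IsOpen (regularLocus (R ⧸ J))` (same proof).
* `exists_notMem_forall_map_eq_family` — finitely many equalities of extended ideals at `𝔭` spread to one basic open
  neighbourhood (the tree's `Ideal.exists_notMem_forall_map_eq`, finitely many times).
* **`exists_notMem_forall_independent`** — `R` Noetherian, `R_𝔭` regular, `a : Fin r → R` with `aᵢ ∈ 𝔭 R_𝔭` and linearly
  independent differentials at `𝔭`, every `Reg(R ⧸ (aᵢ : i ∈ T))` open: there is `f ∉ 𝔭` such that for every prime `𝔮 ∌ f`,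
  `R_𝔮` is a regular local ring and EVERY injective sub-family `a ∘ ε` of elements lying in `𝔮` has independent
  differentials in `R_𝔮`, stated in the relation form «`∑ cⱼ · a(εⱼ) ∈ 𝔪² ⇒ cⱼ ∈ 𝔪`» that `exists_extend_to_rsop` consumes.

## References (for the mathematics; nothing here is a statement of the manuscript under review)
* H. Matsumura, *Commutative Ring Theory* (1986), Thm. 14.2; §32 p. 260 (J-2). [Matsumura1987]
* The Stacks Project, Tags 07P7 (J-2), 0BIA. [StacksProject]
-/

-- `Summit.<Summit>.<Sub>.Theorems` with `Sub = Summit` (single-conjunct summit, D-0017)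
set_option linter.dupNamespace false

noncomputable section

open IsLocalRing Literature.AlgebraicGeometry.Resolution

namespace Summit.ResolutionOfSingularities.ResolutionOfSingularities.Theorems

universe u

namespace DepthSNC

variable {R : Type u} [CommRing R]

/-! ## §1 The regular locus of a quotient around a prime, from an open regular locus -/

/-- **The regular locus of a quotient, around a prime** (the tree's `exists_notMem_forall_isRegularLocalRing_quotient`
with «finite type over a perfect field» replaced by the hypothesis that `Reg(R ⧸ J)` is open — e.g. `R` a J-2 ring):
if `J ⊆ 𝔭` and `R_𝔭 ⧸ J R_𝔭` is regular, then `R_𝔮 ⧸ J R_𝔮` is regular for all primes `𝔮 ⊇ J` in a basic open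
neighbourhood `D(g) ∋ 𝔭`. [cite: Matsumura1987, §32 p. 260 Definition] -/
theorem exists_notMem_forall_isRegularLocalRing_quotient_of_isOpen (J 𝔭 : Ideal R) [𝔭.IsPrime] (hJ : J ≤ 𝔭)
    (hopen : IsOpen (regularLocus (R ⧸ J)))
    (hreg : IsRegularLocalRing
      (Localization.AtPrime 𝔭 ⧸ J.map (algebraMap R (Localization.AtPrime 𝔭)))) :
    ∃ g ∉ 𝔭, ∀ (𝔮 : Ideal R) [𝔮.IsPrime], g ∉ 𝔮 → J ≤ 𝔮 →
      IsRegularLocalRing (Localization.AtPrime 𝔮 ⧸ J.map (algebraMap R (Localization.AtPrime 𝔮))) := by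
  classical
  let S := R ⧸ J
  haveI h𝔭' : (𝔭.map (Ideal.Quotient.mk J)).IsPrime := Ideal.isPrime_map_quotientMk_of_isPrime hJ
  let P : PrimeSpectrum S := ⟨𝔭.map (Ideal.Quotient.mk J), h𝔭'⟩
  have hP : P ∈ regularLocus S := (isRegularLocalRing_localization_quotient_iff J 𝔭 hJ).mp hreg
  obtain ⟨_, ⟨gbar, rfl⟩, hPg, hgU⟩ :=
    PrimeSpectrum.isTopologicalBasis_basic_opens.exists_subset_of_mem_open hP hopen
  obtain ⟨g, rfl⟩ := Ideal.Quotient.mk_surjective gbar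
  refine ⟨g, fun hg => hPg (Ideal.mem_map_of_mem _ hg), fun 𝔮 _ hg𝔮 hJ𝔮 => ?_⟩
  haveI h𝔮' : (𝔮.map (Ideal.Quotient.mk J)).IsPrime := Ideal.isPrime_map_quotientMk_of_isPrime hJ𝔮
  let Q : PrimeSpectrum S := ⟨𝔮.map (Ideal.Quotient.mk J), h𝔮'⟩
  have hQg : Q ∈ PrimeSpectrum.basicOpen (Ideal.Quotient.mk J g) := by
    change Ideal.Quotient.mk J g ∉ 𝔮.map (Ideal.Quotient.mk J)
    intro hmem
    apply hg𝔮
    have : g ∈ (𝔮.map (Ideal.Quotient.mk J)).comap (Ideal.Quotient.mk J) := hmem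
    rwa [Ideal.comap_map_of_surjective _ Ideal.Quotient.mk_surjective, ← RingHom.ker_eq_comap_bot,
      Ideal.mk_ker, sup_eq_left.mpr hJ𝔮] at this
  exact (isRegularLocalRing_localization_quotient_iff J 𝔮 hJ𝔮).mpr (hgU hQg)

/-! ## §2 Finitely many extended-ideal equalities spread at once -/

/-- **Finitely many equalities of extended ideals at a prime spread to one neighbourhood** (Noetherian ring).
[folklore] -/
theorem exists_notMem_forall_map_eq_family [IsNoetherianRing R] (𝔭 : Ideal R) [𝔭.IsPrime] {ι : Type*}
    [Finite ι] (I I' : ι → Ideal R)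
    (h : ∀ i, (I i).map (algebraMap R (Localization.AtPrime 𝔭)) =
      (I' i).map (algebraMap R (Localization.AtPrime 𝔭))) :
    ∃ f ∉ 𝔭, ∀ (𝔮 : Ideal R) [𝔮.IsPrime], f ∉ 𝔮 → ∀ i,
      (I i).map (algebraMap R (Localization.AtPrime 𝔮)) =
        (I' i).map (algebraMap R (Localization.AtPrime 𝔮)) := by
  classical
  haveI := Fintype.ofFinite ι
  choose f hf hfq using fun i =>
    Ideal.exists_notMem_forall_map_eq 𝔭 (IsNoetherian.noetherian (I i)) (IsNoetherian.noetherian (I' i)) (h i)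
  refine ⟨∏ i, f i, prod_mem (S := 𝔭.primeCompl) fun i _ => hf i, fun 𝔮 _ hfq' i => ?_⟩
  exact hfq i 𝔮 (notMem_of_dvd_of_notMem (Finset.dvd_prod_of_mem f (Finset.mem_univ i)) hfq')

/-! ## §3 The family theorem -/

/-- **Independent differentials spread from a prime to a neighbourhood, family form.** Let `R` be Noetherian with
`R_𝔭` regular, `a : Fin r → R` elements of `𝔭` whose images in `R_𝔭` have linearly independent differentials, and
assume `Reg(R ⧸ (aᵢ : i ∈ T))` is open for every `T ⊆ Fin r` (J-2). Then there is `f ∉ 𝔭` such that for every prime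
`𝔮 ∌ f`: `R_𝔮` is regular, and for every injective sub-family `a ∘ ε` of elements of `𝔮`, the relation form of the
linear independence of the differentials `d a(εⱼ) ∈ 𝔪_𝔮/𝔪_𝔮²` holds: `∑ⱼ cⱼ a(εⱼ) ∈ 𝔪_𝔮² ⇒ ∀ j, cⱼ ∈ 𝔪_𝔮`. Proof =
the tree's `IsSNCIdeal.exists_notMem_forall` steps (3)–(5) verbatim with the product dropped: (a) regular quotients
`R_𝔮 ⧸ (aᵢ : i ∈ T)` near `𝔭` (§1), (b) minimal primes of `(aᵢ : i ∈ T)` near `𝔭` inside `𝔭`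
(`Ideal.exists_notMem_forall_minimalPrimes_le`), then at `𝔮` the key step `algebraMap_notMem_map_span_image` gives the
minimality «no `a(εⱼ)` in the ideal of the others» and Matsumura 14.2
(`linearIndependent_toCotangent_of_isRegularLocalRing_quotient`) the independence. [cite: Matsumura1987, Thm. 14.2] -/
theorem exists_notMem_forall_independent [IsNoetherianRing R] (𝔭 : Ideal R) [𝔭.IsPrime]
    [IsRegularLocalRing (Localization.AtPrime 𝔭)] {r : ℕ} (a : Fin r → R)
    (hx' : ∀ i, algebraMap R (Localization.AtPrime 𝔭) (a i) ∈ maximalIdeal (Localization.AtPrime 𝔭))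
    (hli' : LinearIndependent (ResidueField (Localization.AtPrime 𝔭)) fun i =>
      (maximalIdeal (Localization.AtPrime 𝔭)).toCotangent ⟨algebraMap R _ (a i), hx' i⟩)
    (hopen : ∀ T : Finset (Fin r), IsOpen (regularLocus (R ⧸ Ideal.span (a '' (T : Set (Fin r)))))) :
    ∃ f ∉ 𝔭, ∀ (𝔮 : Ideal R) [𝔮.IsPrime], f ∉ 𝔮 →
      IsRegularLocalRing (Localization.AtPrime 𝔮) ∧
      ∀ (t : ℕ) (ε : Fin t → Fin r), Function.Injective ε → (∀ j, a (ε j) ∈ 𝔮) →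
        ∀ c : Fin t → Localization.AtPrime 𝔮,
          ∑ j, c j * algebraMap R (Localization.AtPrime 𝔮) (a (ε j)) ∈
              (maximalIdeal (Localization.AtPrime 𝔮)) ^ 2 →
            ∀ j, c j ∈ maximalIdeal (Localization.AtPrime 𝔮) := by
  classical
  set A := Localization.AtPrime 𝔭 with hA
  have ha𝔭 : ∀ i, a i ∈ 𝔭 := fun i =>
    (IsLocalization.AtPrime.to_map_mem_maximal_iff A 𝔭 (a i)).mp (hx' i)
  let x' : Fin r → A := fun i => algebraMap R A (a i)
  /- the ideals `J T = (a i : i ∈ T)`; at `𝔭` their extensions are generated by elements with independent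
  differentials -/
  let J : Finset (Fin r) → Ideal R := fun T => Ideal.span (a '' (T : Set (Fin r)))
  have hJA : ∀ T, (J T).map (algebraMap R A) = Ideal.span (x' '' (T : Set (Fin r))) := by
    intro T
    rw [Ideal.map_span, Set.image_image]
  have hJle : ∀ (T : Finset (Fin r)) (𝔮 : Ideal R), (∀ i ∈ T, a i ∈ 𝔮) → J T ≤ 𝔮 := by
    intro T 𝔮 hT
    rw [Ideal.span_le]
    rintro _ ⟨i, hi, rfl⟩
    exact hT i hi
  have hJ𝔭 : ∀ T, J T ≤ 𝔭 := fun T => hJle T 𝔭 fun i _ => ha𝔭 i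
  have hregJ : ∀ T, IsRegularLocalRing (A ⧸ (J T).map (algebraMap R A)) := by
    intro T
    haveI := isRegularLocalRing_quotient_span_image_of_linearIndependent_toCotangent x' hx' hli'
      (T : Set (Fin r))
    exact IsRegularLocalRing.of_ringEquiv (Ideal.quotEquivOfEq (hJA T).symm)
  -- (a) regular loci of the `R / J T` around `𝔭`
  choose g hg hgreg using fun T : Finset (Fin r) =>
    exists_notMem_forall_isRegularLocalRing_quotient_of_isOpen (J T) 𝔭 (hJ𝔭 T) (hopen T) (hregJ T)
  -- (b) minimal primes of the `J T` near `𝔭` lie inside `𝔭`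
  choose hm hhm hhmin using fun T : Finset (Fin r) =>
    Ideal.exists_notMem_forall_minimalPrimes_le (J T) 𝔭
  /- the element `f` -/
  refine ⟨∏ T, (g T * hm T), prod_mem (S := 𝔭.primeCompl) fun T _ => mul_mem (hg T) (hhm T),
    fun 𝔮 _ hf𝔮 => ?_⟩
  /- at a prime `𝔮 ∌ f` -/
  set B := Localization.AtPrime 𝔮 with hB
  have hg𝔮 : ∀ T, g T ∉ 𝔮 := fun T =>
    notMem_of_dvd_of_notMem ((dvd_mul_right _ _).trans
      (Finset.dvd_prod_of_mem (fun T => g T * hm T) (Finset.mem_univ T))) hf𝔮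
  have hhm𝔮 : ∀ T, hm T ∉ 𝔮 := fun T =>
    notMem_of_dvd_of_notMem ((dvd_mul_left _ _).trans
      (Finset.dvd_prod_of_mem (fun T => g T * hm T) (Finset.mem_univ T))) hf𝔮
  -- `B` itself is regular (`T = ∅`)
  have hregB : IsRegularLocalRing B := by
    have h0 := hgreg ∅ 𝔮 (hg𝔮 ∅) (hJle ∅ 𝔮 fun i hi => absurd hi (Finset.notMem_empty i))
    have hJ0 : (J ∅).map (algebraMap R B) = ⊥ := by
      change (Ideal.span (a '' ((∅ : Finset (Fin r)) : Set (Fin r)))).map (algebraMap R B) = ⊥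
      rw [Finset.coe_empty, Set.image_empty, Ideal.span_empty, Ideal.map_bot]
    rw [hJ0] at h0
    exact IsRegularLocalRing.of_ringEquiv (RingEquiv.quotientBot B)
  refine ⟨hregB, fun t ε hε hε𝔮 => ?_⟩
  haveI := hregB
  -- the sub-family `z j = a (ε j)` in `B`
  let z : Fin t → B := fun j => algebraMap R B (a (ε j))
  have hz : ∀ j, z j ∈ maximalIdeal B := fun j =>
    (IsLocalization.AtPrime.to_map_mem_maximal_iff B 𝔮 _).mpr (hε𝔮 j)
  -- images of sub-families of `Fin t` as extensions of the `J T`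
  let ι' : Finset (Fin t) → Finset (Fin r) := fun S => S.image ε
  have himage : ∀ S : Finset (Fin t),
      z '' (S : Set (Fin t)) = algebraMap R B '' (a '' (ι' S : Set (Fin r))) := by
    intro S
    simp only [ι', Finset.coe_image, Set.image_image]
    rfl
  have hspanS : ∀ S : Finset (Fin t),
      Ideal.span (z '' (S : Set (Fin t))) = (J (ι' S)).map (algebraMap R B) := by
    intro S
    rw [himage S, Ideal.map_span]
  have hJ𝔮 : ∀ S : Finset (Fin t), J (ι' S) ≤ 𝔮 := by
    intro S
    refine hJle _ 𝔮 fun i hi => ?_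
    obtain ⟨j, -, rfl⟩ := Finset.mem_image.mp hi
    exact hε𝔮 j
  -- (a) at `𝔮`: the quotients `B / (z_S)` are regular
  have hregS : ∀ S : Finset (Fin t),
      IsRegularLocalRing (B ⧸ (J (ι' S)).map (algebraMap R B)) :=
    fun S => hgreg _ 𝔮 (hg𝔮 _) (hJ𝔮 S)
  haveI : IsRegularLocalRing (B ⧸ Ideal.span (Set.range z)) := by
    rw [← Set.image_univ, ← Finset.coe_univ, hspanS]
    exact hregS _
  -- minimality: no `z j` lies in the ideal of the others
  have hmin : ∀ j, z j ∉ Ideal.span (z '' {j' | j' ≠ j}) := by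
    intro j
    have hset : ({j' | j' ≠ j} : Set (Fin t)) = ((Finset.univ.erase j : Finset (Fin t)) : Set (Fin t)) := by
      ext j'
      simp
    rw [hset, hspanS]
    refine algebraMap_notMem_map_span_image 𝔭 𝔮 a hx' hli' _ ?_ (hregS _) ?_
    · intro hi
      obtain ⟨j', hj', hjj'⟩ := Finset.mem_image.mp hi
      exact (Finset.mem_erase.mp hj').1 (hε hjj')
    · intro P hP hP𝔮
      exact hhmin _ P hP fun hh => hhm𝔮 _ (hP𝔮 hh)
  -- Matsumura 14.2: independent differentials, in relation form
  have hli := linearIndependent_toCotangent_of_isRegularLocalRing_quotient z hz hmin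
  exact (linearIndependent_toCotangent_iff_forall_mem z hz).mp hli

end DepthSNC

end Summit.ResolutionOfSingularities.ResolutionOfSingularities.Theorems

end
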